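import Literature.Analysis.FluidPDE.AlbrittonBlowupCriterion
import HarnessLib

/-!
# Albritton's blow-up criterion in Albritton's own class — corrected statement

Analysis/FluidPDE definitions file (definitions and proved API, no named fact) recording a
**faithfulness correction** to the tree's rendering `Literature.Analysis.FluidPDE.albritton_besov_blowup`
(`CriticalRegularity.lean`) of Albritton, *Blow-up criteria for the Navier–Stokes equations in
non-endpoint critical Besov spaces*, Anal. PDE 11 (2018) 1415–1456 = arXiv:1612.04439, **Thm. 1.1**
(numbering of the arXiv version throughout).

## The discrepancy

Thm. 1.1 is printed for "*the* mild solution of the Navier–Stokes equations on `ℝ³ × [0,T*)` with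
initial data `u₀` and maximal time of existence `T*(u₀)`" (§1, p. 4), i.e. for the solution
`NS(u₀)` of **Thm. 4.2** (§4.3): for divergence-free `u₀ ∈ Ḃ^{s_p}_{p,q}`, `3 < p, q < ∞`,
`s_p = -1 + 3/p`, there are `0 < T*(u₀) ≤ ∞` and a mild solution `u` (a solution of the Oseen
integral equation of §4.3, `u(t) = e^{tΔ}u₀ - ∫₀ᵗ e^{(t-s)Δ} ℙ∇·(u ⊗ u) ds`) with, for all `0 < T < T*`,
`u ∈ C([0,T]; Ḃ^{s_p}_{p,q}) ∩ L̃¹_T Ḃ^{s_p+2}_{p,q} ∩ L̃^∞_T Ḃ^{s_p}_{p,q}` ((4.51)) and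
`u ∈ K̊_p(Q_T) ∩ K̊_∞(Q_T) ∩ C((0,T]; L^p ∩ L^∞)` ((4.52)), "the unique mild solution satisfying
(4.51) and the unique mild solution satisfying (4.52)"; if `T* < ∞` then ((4.53), clause (i))
`lim_{t ↑ T*} ‖u(t)‖_{L^{p₀}} = ∞` for all `p₀ ∈ [p, ∞]`. Here (§4.1, the Kato spaces)
`‖u‖_{K^s_p(Q_T)} = sup_{0<t<T} t^{-s/2} ‖u(t)‖_{L^p}`, `K_p = K^{s_p}_p`, `K_∞ = K^{-1}_∞`, and
`K̊^s_p(Q_T) = {u ∈ K^s_p(Q_T) : t^{-s/2}‖u(t)‖_{L^p} → 0 as t ↓ 0}` (display (4.55) after Thm. 4.2).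

The tree's `albritton_besov_blowup` (and `gkp_besov_blowup`) quantify instead over
`IsMaximalBesovMildSolution (-1+3/p) p q T ν u U`: *every* pair `(u, U)` that is a duality-form mild
solution from `t = 0` (`IsMildNSSolutionOn (Ico 0 T)`, Mathlib Bochner integrals, junk value `0`
when an integrand is not integrable), measurable, with `U t` the distribution of `u t`,
`U ∈ C([0,T); Ḃ^{s_p}_{p,q})`, and `u` in Kato's class `K̊_∞` **only** (`MemKatoClassOn`), maximal
among such pairs. This class carries none of the `K_p` / `L̃^r_T Ḃ` information of (4.51)–(4.52),
and no published uniqueness theorem covers it: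

* the bilinear Duhamel operator is *not* bounded on `K_∞ × K_∞`
  (`∫₀^{t/2} (t-s)^{-1/2} s^{-1} ds = ∞`); the printed fixed-point classes always carry an
  `L^p`-type weight with `p < ∞` (Lemarié-Rieusset 2016, Thm. 8.7: `Y_T = K_E ∩ K_∞`, PDF p. 191;
  Thm. 8.8: `K_E`-type weights alone; Kato 1984, Thm. 1: the weights `t^{(1-3/q)/2} ‖u(t)‖_{L^q}`,
  `3 ≤ q ≤ ∞`; Albritton Thm. 4.2: `X_T = L̃^r_T Ḃ^{s_p+2/r}_{p,q} ∩ K̊_p`), so the design note of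
  `CriticalRegularity.lean` ("Kato's class `K_∞` … in which mild solutions are unique") is not
  backed by a printed uniqueness theorem;
* on the tree's class the nonlinear integrand `τ ↦ ∫⟪u τ, (u τ·∇) e^{ν(t-τ)Δ}φ⟫` of the duality
  identity is a priori only `o(τ⁻¹)` at `τ → 0⁺` (from `K̊_∞`; `C_t Ḃ^{s_p}_{p,q}` with `s_p < 0`
  adds no control of `u ⊗ u`), hence possibly non-integrable, in which case the identity holds
  with the junk value and says nothing; even the restart of the identity at a positive time is
  then not derivable (the same diagnosis is recorded in `NSCriticalClosureBesovBounded.lean` and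
  `NSCriticalClosureBesovTranslate.lean`, which keep the restart as an explicit hypothesis);
* the missing `K_p` bound cannot be recovered slice-wise: `L^∞ ∩ Ḃ^{s_p}_{p,q} ⊄ L^p`
  (`f = ∑_{k ≥ 1} cos(2^k x₁) Φ(x - x_k)` with `Φ ∈ 𝓢`, `supp Φ̂ ⊂ B(0, ½)`, and sparse centres
  `x_k`: `f` is bounded; the `k`-th term has spectrum in `B(±2^k e₁, ½)`, so each block `Δ̇_j f`
  sees at most three terms and `‖Δ̇_j f‖_p ≤ C ‖Φ‖_p` uniformly in `j`, whence
  `2^{j s_p}‖Δ̇_j f‖_p ∈ ℓ^q` (`s_p < 0`, no low frequencies); and `‖f‖_{L^p} = ∞`).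

Since `NS(u₀)` with `T* < ∞` *is* maximal in the tree's class (an extension in `K̊_∞` past `T*`
would bound `‖u(t)‖_∞` near `T*`, against Thm. 4.2 (4.53) (i) with `p₀ = ∞`), the tree's statement
implies the printed theorem and asserts it, in addition, for every unidentified member of the
larger class: it is **stated stronger than its source** (its truth is not claimed either way here).
The same applies to the two halves `albritton_singular_point_of_blowup`,
`albritton_regular_of_liminf_besov` of `AlbrittonBlowupCriterion.lean`.

## What this file does

It vendors Albritton's own class, over which the corrected statement is to be stated:

* `MemKatoWeightClassOn α p T u` — Kato's weighted class on `[0, T)`: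
  `sup_{0<τ<t} τ^α ‖u(τ)‖_{L^p} < ∞` for every `t < T` and `t^α ‖u(t)‖_{L^p} → 0` at `0⁺`
  (§4.1 and the `K̊` display (4.55) after Thm. 4.2; for `T ≤ T*` "`u ∈ K̊^s_p(Q_{T'})` for all `T' < T`"
  with `α = -s/2`); `MemKatoClassOn` of `CriticalRegularity.lean` is the case `α = ½`, `p = ∞`
  (`memKatoClassOn_iff_memKatoWeightClassOn`, proved);
* `IsKatoBesovMildSolutionOn p q T ν u U` — the tree's Besov mild class **intersected with
  Albritton's uniqueness class (4.52)**: additionally `u ∈ K̊_p` (weight `(1 - 3/p)/2 = -s_p/2`) and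
  `u ∈ C((0,T); L^p) ∩ C((0,T); L^∞)`; on it the Duhamel integrands are absolutely integrable
  (`‖u(τ)‖_∞ ‖u(τ)‖_p ≲ τ^{-1+3/(2p)}`), the duality form is the tested Oseen equation, and Thm. 4.2
  identifies every member with `NS(u 0)` on `[0, T)`, `T ≤ T*(u 0)`;
* `IsMaximalKatoBesovMildSolution` — no member of this class on a longer interval extends `u`;
  by Thm. 4.2 (uniqueness in (4.52) and (4.53) (i) with `p₀ = ∞`) this is exactly `T = T*(u 0) < ∞`;
* the corrected named fact itself, **Thm. 1.1 over this class**, is *not* declared here: under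
  D-0026 a proving seat may not mint a new unproved fact (`lint.fact-fanout`), so its exact text is
  recorded below for the cite/definition item that vendors it (as `albritton_besov_blowup_katoClass`,
  users taking `(h : albritton_besov_blowup_katoClass)`):

  ```
  -- Albritton 2018, Thm. 1.1, for the mild solution and maximal time of Thm. 4.2 (class (4.52));
  -- tag: cite Albritton2018, Thm. 1.1 (with Thm. 4.2)
  albritton_besov_blowup_katoClass : Prop :=
    ∀ {ν : ℝ} (_hν : 0 < ν) {p q : ℝ≥0∞} [Fact (1 ≤ p)] (_hp₃ : 3 < p) (_hp : p < ∞)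
      (_hq₃ : 3 < q) (_hq : q < ∞) {T : ℝ} (_hT : 0 < T) {u : ℝ → ℝ³ → ℝ³} {U : ℝ → 𝓢'(ℝ³, ℂ³)}
      (_hmax : IsMaximalKatoBesovMildSolution p q T ν u U),
      Tendsto (fun t => FunctionSpaces.eHomBesovNorm (-1 + 3 / p.toReal) p q (U t)) (𝓝[<] T) (𝓝 ∞)
  ```

  (viscosity `ν > 0` as for all facts of `CriticalRegularity.lean`; Albritton takes `ν = 1`, apply
  the printed theorem to `w(s, y) = ν⁻¹ u(s/ν, y)`; data function-valued, seen through `U`). The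
  corrected forms of the two halves of `AlbrittonBlowupCriterion.lean` are obtained likewise by
  replacing `IsMaximalBesovMildSolution` / `IsBesovMildSolutionOn (-1+3/p) p p` with
  `IsMaximalKatoBesovMildSolution` / `IsKatoBesovMildSolutionOn p p`.

Nothing accepted is changed; `albritton_besov_blowup` keeps its statement and name.

## References

* D. Albritton, Anal. PDE 11 (2018) 1415–1456 = arXiv:1612.04439: Thm. 1.1 (p. 4); §4.1 (Kato
  spaces `K^s_{p,q}(Q_T)`, caloric characterisation); Thm. 4.2 with (4.51), (4.52), (4.53) (i), the display (4.55)
  defining `K̊^s_p(Q_T)`, and Steps 3–4 of its proof (uniqueness, maximal time). [Albritton2018]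
* T. Kato, Math. Z. 187 (1984) 471–480, (1.2) and Thm. 1 (the weights `t^{(1-3/q)/2}`). [Kato1984]
* P. G. Lemarié-Rieusset, *The Navier–Stokes Problem in the 21st Century* (2016), Thm. 8.7
  (the space `Y_T`, PDF p. 191). [LemarieRieusset2016]
* H. Bahouri, J.-Y. Chemin, R. Danchin, *Fourier Analysis and Nonlinear PDE* (2011), Thm. 2.34,
  Thm. 5.40. [BahouriCheminDanchin2011]
-/

noncomputable section

open MeasureTheory TemperedDistribution Set Function Filter Metric
open _root_.Topology
open scoped SchwartzMap ENNReal NNReal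

namespace Literature.Analysis.FluidPDE

/-- Local notation for physical space `ℝ³ = EuclideanSpace ℝ (Fin 3)`. -/
local notation "ℝ³" => EuclideanSpace ℝ (Fin 3)

/-- Local notation for the complexified target `ℂ³ = EuclideanSpace ℂ (Fin 3)`. -/
local notation "ℂ³" => EuclideanSpace ℂ (Fin 3)

/-! ### Kato's weighted classes `K̊^s_p` -/

section KatoWeight

variable {ι : Type*} [Fintype ι]

/-- **Kato's weighted class on `[0, T)`** with weight `t^α` in `L^p` (Albritton 2018, §4.1:
`‖u‖_{K^s_{p,∞}(Q_T)} = sup_{0<t<T} t^{-s/2} ‖u(t)‖_{L^p}`, and the display (4.55) after Thm. 4.2: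
`K̊^s_p(Q_T) = {u ∈ K^s_p(Q_T) : t^{-s/2} ‖u(t)‖_{L^p} → 0 as t ↓ 0}`; Kato 1984, Thm. 1, the
weights `t^{(1-3/q)/2} u ∈ C([0,T]; L^q)` vanishing at `t = 0`): with `α = -s/2`,
`sup_{0<τ<t} τ^α ‖u(τ)‖_{L^p} < ∞` for every `t < T` (membership in `K^s_p(Q_t)` for all `t < T`,
the form in which Thm. 4.2 asserts it below the maximal time) and `t^α ‖u(t)‖_{L^p} → 0` as
`t → 0⁺`. Same shape as `MemKatoClassOn` (`= α = ½`, `p = ∞`,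
`memKatoClassOn_iff_memKatoWeightClassOn`); the second clause does not depend on `T`.
[cite: Albritton2018, §4.1 (4.8)–(4.10) and Thm. 4.2 (4.52), (4.55)] -/
def MemKatoWeightClassOn (α : ℝ) (p : ℝ≥0∞) (T : ℝ)
    (u : ℝ → EuclideanSpace ℝ ι → EuclideanSpace ℝ ι) : Prop :=
  (∀ t < T, ⨆ τ ∈ Ioo 0 t, ENNReal.ofReal (τ ^ α) * eLpNorm (u τ) p volume < ∞) ∧
    Tendsto (fun t => ENNReal.ofReal (t ^ α) * eLpNorm (u t) p volume) (𝓝[>] 0) (𝓝 0)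

/-- Kato's weighted class is monotone in the lifespan (definitional). [folklore] -/
theorem MemKatoWeightClassOn.mono {α : ℝ} {p : ℝ≥0∞} {T T' : ℝ}
    {u : ℝ → EuclideanSpace ℝ ι → EuclideanSpace ℝ ι} (h : MemKatoWeightClassOn α p T u)
    (hT : T' ≤ T) : MemKatoWeightClassOn α p T' u :=
  ⟨fun t ht => h.1 t (ht.trans_le hT), h.2⟩

/-- The weighted bound at one time `τ ∈ (0, t)`, `t < T`, is finite for a member of Kato's
weighted class (the `sup` over `(0, t)` dominates each term). [folklore] -/
theorem MemKatoWeightClassOn.mul_eLpNorm_lt_top {α : ℝ} {p : ℝ≥0∞} {T : ℝ}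
    {u : ℝ → EuclideanSpace ℝ ι → EuclideanSpace ℝ ι} (h : MemKatoWeightClassOn α p T u)
    {t τ : ℝ} (ht : t < T) (hτ : τ ∈ Ioo 0 t) :
    ENNReal.ofReal (τ ^ α) * eLpNorm (u τ) p volume < ∞ :=
  lt_of_le_of_lt (le_iSup₂ (f := fun τ (_ : τ ∈ Ioo 0 t) =>
    ENNReal.ofReal (τ ^ α) * eLpNorm (u τ) p volume) τ hτ) (h.1 t ht)

/-- Every slice `u τ`, `0 < τ < T`, of a member of Kato's weighted class lies in `L^p`
(`τ^α > 0` for `τ > 0`, so `‖u(τ)‖_{L^p} < ∞`), given measurability. [folklore] -/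
theorem MemKatoWeightClassOn.eLpNorm_lt_top {α : ℝ} {p : ℝ≥0∞} {T : ℝ}
    {u : ℝ → EuclideanSpace ℝ ι → EuclideanSpace ℝ ι} (h : MemKatoWeightClassOn α p T u)
    {τ : ℝ} (hτ : 0 < τ) (hτT : τ < T) : eLpNorm (u τ) p volume < ∞ := by
  obtain ⟨t, hτt, htT⟩ := exists_between hτT
  have hfin := h.mul_eLpNorm_lt_top htT ⟨hτ, hτt⟩
  have hpos : ENNReal.ofReal (τ ^ α) ≠ 0 := by
    rw [Ne, ENNReal.ofReal_eq_zero, not_le]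
    exact Real.rpow_pos_of_pos hτ α
  by_contra htop
  rw [not_lt, top_le_iff] at htop
  rw [htop, ENNReal.mul_top hpos] at hfin
  exact lt_irrefl _ hfin

/-- **`MemKatoClassOn` is the case `α = ½`, `p = ∞` of Kato's weighted class** (`√t = t^{1/2}`,
Mathlib's `Real.sqrt_eq_rpow`; Albritton 2018, §4.1, `K_∞ = K^{-1}_∞`). [folklore] -/
theorem memKatoClassOn_iff_memKatoWeightClassOn {T : ℝ}
    {u : ℝ → EuclideanSpace ℝ ι → EuclideanSpace ℝ ι} :
    MemKatoClassOn T u ↔ MemKatoWeightClassOn (1 / 2) ∞ T u := by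
  simp only [MemKatoClassOn, MemKatoWeightClassOn, Real.sqrt_eq_rpow]

end KatoWeight

/-! ### Albritton's class (4.52) and its maximal solutions -/

/-- **Besov mild solutions in Albritton's uniqueness class (4.52)** (Albritton 2018, Thm. 4.2:
the mild solution `NS(u₀)` of divergence-free data `u₀ ∈ Ḃ^{s_p}_{p,q}`, `3 < p, q < ∞`, lies in
`C([0,T]; Ḃ^{s_p}_{p,q})` ((4.51)) and in `K̊_p(Q_T) ∩ K̊_∞(Q_T) ∩ C((0,T]; L^p ∩ L^∞)` ((4.52)) for
all `0 < T < T*(u₀)`, and is "the unique mild solution satisfying (4.52)"). Rendering on `[0, T)`,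
`T ≤ T*`: `(u, U)` is a Besov mild solution of the tree's class `IsBesovMildSolutionOn (-1+3/p) p q`
(duality-form mild from its datum `u 0`, measurable, `U t` the distribution of `u t`,
`U ∈ C([0,T); Ḃ^{-1+3/p}_{p,q})`, Kato's class `K̊_∞`), **and** `u ∈ K̊_p` with the critical weight
`t^{(1 - 3/p)/2} = t^{-s_p/2}` (`MemKatoWeightClassOn`), **and** `u ∈ C((0,T); L^p)`,
`u ∈ C((0,T); L^∞)` (`ContinuousInLpOn`). On this class the Duhamel integrands of the duality
identity are absolutely integrable and Thm. 4.2 identifies `u` with `NS(u 0)` on `[0, T)`. For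
`p = ∞` Lean's `3 / p.toReal = 0` would turn the weight into `½`; the class is only used with
`3 < p < ∞`. [cite: Albritton2018, Thm. 4.2 (4.52)] -/
structure IsKatoBesovMildSolutionOn (p q : ℝ≥0∞) [Fact (1 ≤ p)] (T ν : ℝ) (u : ℝ → ℝ³ → ℝ³)
    (U : ℝ → 𝓢'(ℝ³, ℂ³)) : Prop where
  /-- `(u, U)` is a Besov mild solution on `[0, T)` in the class `C([0,T); Ḃ^{-1+3/p}_{p,q}) ∩ K̊_∞`
  of `CriticalRegularity.lean`. -/
  isBesovMildSolutionOn : IsBesovMildSolutionOn (-1 + 3 / p.toReal) p q T ν u U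
  /-- `u ∈ K̊_p`: `sup_{0<τ<t} τ^{(1-3/p)/2} ‖u(τ)‖_{L^p} < ∞` for `t < T`, `→ 0` at `0⁺`
  (Albritton 2018, (4.52)). -/
  memKatoWeightClassOn : MemKatoWeightClassOn ((1 - 3 / p.toReal) / 2) p T u
  /-- `u ∈ C((0,T); L^p)` (Albritton 2018, (4.52)). -/
  continuousInLpOn : ContinuousInLpOn (Ioo 0 T) p u
  /-- `u ∈ C((0,T); L^∞)` (Albritton 2018, (4.52)). -/
  continuousInLpOn_top : ContinuousInLpOn (Ioo 0 T) ∞ u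

namespace IsKatoBesovMildSolutionOn

variable {p q : ℝ≥0∞} [Fact (1 ≤ p)] {T T' ν : ℝ} {u : ℝ → ℝ³ → ℝ³} {U : ℝ → 𝓢'(ℝ³, ℂ³)}

/-- Restriction of a solution of Albritton's class to a shorter lifespan `T' ≤ T` (definitional).
[folklore] -/
theorem mono (h : IsKatoBesovMildSolutionOn p q T ν u U) (hT : T' ≤ T) :
    IsKatoBesovMildSolutionOn p q T' ν u U where
  isBesovMildSolutionOn := h.isBesovMildSolutionOn.mono hT
  memKatoWeightClassOn := h.memKatoWeightClassOn.mono hT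
  continuousInLpOn := h.continuousInLpOn.mono (Ioo_subset_Ioo_right hT)
  continuousInLpOn_top := h.continuousInLpOn_top.mono (Ioo_subset_Ioo_right hT)

/-- A member of Albritton's class is in Kato's class `K̊_∞` (projection through the tree's Besov
mild class; Albritton 2018, (4.52)). [cite: Albritton2018, Thm. 4.2 (4.52)] -/
theorem memKatoClassOn (h : IsKatoBesovMildSolutionOn p q T ν u U) : MemKatoClassOn T u :=
  h.isBesovMildSolutionOn.memKatoClassOn

/-- The initial slice of a member of Albritton's class on `[0, T)`, `0 < T`, is weakly divergence
free (projection of the mild predicate at `t = 0`; Albritton 2018, Thm. 4.2: "divergence-free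
vector field"). [cite: Albritton2018, Thm. 4.2] -/
theorem isWeaklyDivFree_zero (h : IsKatoBesovMildSolutionOn p q T ν u U) (hT : 0 < T) :
    IsWeaklyDivFree (u 0) :=
  h.isBesovMildSolutionOn.isWeaklyDivFree_zero hT

/-- Every slice `u t`, `0 < t < T`, of a member of Albritton's class lies in `L^p ∩ L^∞`
(Albritton 2018, (4.52): `C((0,T]; L^p ∩ L^∞)`). [cite: Albritton2018, Thm. 4.2 (4.52)] -/
theorem memLp_and_memLp_top (h : IsKatoBesovMildSolutionOn p q T ν u U) {t : ℝ}
    (ht : t ∈ Ioo 0 T) : MemLp (u t) p volume ∧ MemLp (u t) ∞ volume :=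
  ⟨h.continuousInLpOn.1 t ht, h.continuousInLpOn_top.1 t ht⟩

end IsKatoBesovMildSolutionOn

/-- **Maximal solutions in Albritton's class** (Albritton 2018, Thm. 4.2 and Step 4 of its proof:
the maximal time of existence `T*(u₀)` of `NS(u₀)`, "for all `T > T*(u₀)`, the solution `u`
cannot be extended"): `(u, U)` is a member of Albritton's class on `[0, T)` and no member
`(v, V)` of the class on a longer interval `[0, T')`, `T' > T`, agrees with `u` a.e. at every
time of `[0, T)`. For `0 < T < ∞` this is exactly "`u = NS(u 0)` and `T = T*(u 0)`": by
uniqueness in (4.52) a member on `[0, T)` is `NS(u 0)` there and `T ≤ T*` (no member extends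
`NS(u₀)` past `T*`, since its `K̊_∞` bound would keep `‖u(t)‖_∞` bounded near `T*`, against
Thm. 4.2 (4.53) (i) with `p₀ = ∞`), while for `T < T*` the restriction of `NS(u 0)` to a longer interval
is an extension in the class. Twin of `IsMaximalBesovMildSolution`. [cite: Albritton2018, Thm. 4.2 (maximal time of existence)] -/
structure IsMaximalKatoBesovMildSolution (p q : ℝ≥0∞) [Fact (1 ≤ p)] (T ν : ℝ)
    (u : ℝ → ℝ³ → ℝ³) (U : ℝ → 𝓢'(ℝ³, ℂ³)) : Prop where
  /-- `(u, U)` is a member of Albritton's class on `[0, T)`. -/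
  isKatoBesovMildSolutionOn : IsKatoBesovMildSolutionOn p q T ν u U
  /-- No member of Albritton's class on a longer interval extends `u`. -/
  not_extendable : ¬ ∃ T' > T, ∃ (v : ℝ → ℝ³ → ℝ³) (V : ℝ → 𝓢'(ℝ³, ℂ³)),
      IsKatoBesovMildSolutionOn p q T' ν v V ∧ ∀ t ∈ Ico 0 T, v t =ᵐ[volume] u t

/-- A maximal solution of Albritton's class is in particular a Besov mild solution of the tree's
class (projection). [folklore] -/
theorem IsMaximalKatoBesovMildSolution.isBesovMildSolutionOn {p q : ℝ≥0∞} [Fact (1 ≤ p)]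
    {T ν : ℝ} {u : ℝ → ℝ³ → ℝ³} {U : ℝ → 𝓢'(ℝ³, ℂ³)}
    (h : IsMaximalKatoBesovMildSolution p q T ν u U) :
    IsBesovMildSolutionOn (-1 + 3 / p.toReal) p q T ν u U :=
  h.isKatoBesovMildSolutionOn.isBesovMildSolutionOn

/-- A member of Albritton's class on a longer interval `[0, T')`, `T < T'`, is not maximal with
lifespan `T` (it extends its own restriction; Albritton 2018, Thm. 4.2, Step 4). [cite: Albritton2018, Thm. 4.2] -/
theorem IsKatoBesovMildSolutionOn.not_isMaximalKatoBesovMildSolution {p q : ℝ≥0∞} [Fact (1 ≤ p)]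
    {T T' ν : ℝ} (hTT' : T < T') {u : ℝ → ℝ³ → ℝ³} {U : ℝ → 𝓢'(ℝ³, ℂ³)}
    (h : IsKatoBesovMildSolutionOn p q T' ν u U) : ¬ IsMaximalKatoBesovMildSolution p q T ν u U :=
  fun hmax => hmax.not_extendable ⟨T', hTT', u, U, h, fun _ _ => ae_eq_refl _⟩

end Literature.Analysis.FluidPDE

end
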